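import Summits.QuantumFields.YangMills.Theorems.TwistExponentGapLatticeCocycle
import Summits.QuantumFields.YangMills.Theorems.TwistExponentGapCovConstOfFiniteStabilizer
import Summits.QuantumFields.YangMills.Theorems.TwistExponentGapStabilizerFinite
import Literature.MathematicalPhysics.QuantumLattice.RepLieAlgebra
import Literature.MathematicalPhysics.QuantumLattice.LatticeWilsonFlow
import HarnessLib

/-!
# Infinitesimal rigidity of twisted-flat lattice connections under pair-rigidity (`h¹ = 0`; step (W2) of ⟨stmt-QuantumFields-24054⟩)
# (route-independent helper toward the crux `TwistExponentGap.RigidTwistCeiling`; free hands of width seat ym-line-sfw-p2-w3)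

Assembly of the rigidity algebra at the data of the crux: compact `G`, lattice representation `r` (faithful, unitary, continuous),
torus `(ℤ/S)^d`, central `z` with pair-rigidity, and a configuration `U₀` that is `z`-twisted flat for the crux's inline twist
(`z_p · U₀,p = 1` for every plaquette `p`, `z_p = z` exactly on the stack `p.2 = q ∧ p.1 q.1.1 = 0 ∧ p.1 q.1.2 = 0`).  Let
`𝔤 = repLieAlgebra r ⊆ M_N(ℂ)` (the Lie algebra of `r(G)`, tree `QuantumLattice/RepLieAlgebra`) and `Ad_u Y = r(u) Y r(u⁻¹)`.

`twistedFlat_cocycle_exact` (**`h¹ = 0`**): every `𝔤`-valued lattice 1-cochain `X` satisfying the `Ad ∘ r ∘ U₀`-twisted cocycle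
condition `Ad_{U₀(x,μ)} X_ν(x+e_μ) − X_ν(x) = Ad_{U₀(x,ν)} X_μ(x+e_ν) − X_μ(x)` is a twisted coboundary
`X_μ(x) = Ad_{U₀(x,μ)} ξ(x+e_μ) − ξ(x)` with `ξ` `𝔤`-valued.  I.e. the kernel of the Hessian of the twisted Wilson action at `U₀`
(linearised curvature `= 0`) consists of infinitesimal gauge transformations only.

Proof = the chain landed today: `Ad` acts on `𝔤` by linear isometries of the Hilbert–Schmidt inner product (`conj_mem_repLieAlgebra`,
unitary invariance of the Frobenius norm), the central twist is invisible to `Ad` on `𝔤` (`eq_of_forall_exp_smul_eq`), so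
`Ad ∘ r ∘ U₀` is a FLAT orthogonal lattice connection; its `h⁰` vanishes by `finite_stabilizer_of_twistedFlat` (✓p775680) and
`covConst_eq_zero_of_finite_stabilizer` (✓p775565); hence `h¹ = 0` by `lattice_cocycle_exact` (✓p775432).
What remains for ⟨24054⟩ after this file: ONLY the analytic step (W3) — the exponential-chart tangent calculus turning this
`h¹ = 0` into the local quadratic-growth inequality (MB_loc) consumed by ✓p775343.
HONEST FRAMING: linear algebra on a finite lattice; nothing here bears on a summit statement or on the Yang–Mills mass gap.
-/

set_option autoImplicit false

noncomputable section

open scoped Matrix Matrix.Norms.Frobenius RealInnerProductSpace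
open NormedSpace
open Literature.MathematicalPhysics.QuantumFieldTheory
open Literature.MathematicalPhysics.QuantumLattice

namespace Summit.QuantumFields.YangMills.Theorems.TwistExponentGap

variable {G : Type*} [Group G] [TopologicalSpace G] [CompactSpace G]

/-- Central elements act trivially on the Lie algebra: `r(c) Y = Y r(c)` for `c ∈ Z(G)` and `Y ∈ 𝔤_r`. -/
theorem rho_center_mul_eq_mul (r : LatticeRep G) {c : G} (hc : c ∈ Subgroup.center G)
    {Y : Matrix (Fin r.N) (Fin r.N) ℂ} (hY : Y ∈ repLieAlgebra r) : r.ρ c * Y = Y * r.ρ c := by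
  have hY' := (mem_repLieAlgebra_iff r).1 hY
  -- `exp(t · r(c) Y r(c⁻¹)) = r(c) exp(tY) r(c⁻¹) = exp(tY)` for all real `t`
  have hconj : r.ρ c * Y * r.ρ c⁻¹ = Y := by
    apply eq_of_forall_exp_smul_eq
    intro t
    obtain ⟨k, hk⟩ := hY' t
    have hs : SemiconjBy (r.ρ c) Y (r.ρ c * Y * r.ρ c⁻¹) := by
      show r.ρ c * Y = r.ρ c * Y * r.ρ c⁻¹ * r.ρ c
      rw [mul_assoc (r.ρ c * Y), ← map_mul, inv_mul_cancel, map_one, mul_one]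
    have h1 := (hs.smul_right t).exp_right
    -- `exp(tY) = r k` commutes with `r c`
    have hck : r.ρ c * exp (t • Y) = exp (t • Y) * r.ρ c := by
      have : exp (t • Y) = r.ρ k := by rw [hk]; rfl
      rw [this, ← map_mul, ← map_mul, (Subgroup.mem_center_iff.1 hc k)]
    have h2 : r.ρ c * exp (t • Y) = exp (t • (r.ρ c * Y * r.ρ c⁻¹)) * r.ρ c := h1.eq
    rw [hck] at h2
    have hcc : r.ρ c * r.ρ c⁻¹ = 1 := by rw [← map_mul, mul_inv_cancel, map_one]
    have h3 : exp (t • Y) * r.ρ c * r.ρ c⁻¹ = exp (t • (r.ρ c * Y * r.ρ c⁻¹)) * r.ρ c * r.ρ c⁻¹ := by rw [h2]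
    rw [mul_assoc (exp (t • Y)), mul_assoc (exp (t • (r.ρ c * Y * r.ρ c⁻¹))), hcc, mul_one, mul_one] at h3
    exact h3.symm
  calc r.ρ c * Y = r.ρ c * Y * r.ρ c⁻¹ * r.ρ c := by
        rw [mul_assoc (r.ρ c * Y), ← map_mul, inv_mul_cancel, map_one, mul_one]
    _ = Y * r.ρ c := by rw [hconj]

/-- **Infinitesimal rigidity of twisted-flat configurations (`h¹ = 0`).**  Under the hypotheses of the crux (pair-rigidity of the
central `z`) every `𝔤_r`-valued 1-cocycle of the `Ad ∘ r ∘ U₀`-twisted lattice complex at a `z`-twisted-flat `U₀` is a coboundary. -/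
theorem twistedFlat_cocycle_exact (r : LatticeRep G) {d S : ℕ} [NeZero S] (U₀ : GaugeConfig d S G)
    (q : {p : Fin d × Fin d // p.1 < p.2}) (z : G) (hz : z ∈ Subgroup.center G)
    (hrig : ∀ x y : G, x * y * x⁻¹ * y⁻¹ = z → Set.Finite {k : G | k * x = x * k ∧ k * y = y * k})
    (htf : ∀ p : Plaquette d S, (if p.2 = q ∧ p.1 q.1.1 = 0 ∧ p.1 q.1.2 = 0 then z else 1) *
      plaquetteHolonomy U₀ p.1 p.2.1.1 p.2.1.2 = 1)
    (X : Fin d → Site d S → Matrix (Fin r.N) (Fin r.N) ℂ) (hX : ∀ μ x, X μ x ∈ repLieAlgebra r)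
    (hcoc : ∀ (x : Site d S) (μ ν : Fin d),
      r.ρ (U₀ (x, μ)) * X ν (x.shift μ) * r.ρ (U₀ (x, μ))⁻¹ - X ν x =
        r.ρ (U₀ (x, ν)) * X μ (x.shift ν) * r.ρ (U₀ (x, ν))⁻¹ - X μ x) :
    ∃ ξ : Site d S → Matrix (Fin r.N) (Fin r.N) ℂ, (∀ x, ξ x ∈ repLieAlgebra r) ∧
      ∀ (x : Site d S) (μ : Fin d), X μ x = r.ρ (U₀ (x, μ)) * ξ (x.shift μ) * r.ρ (U₀ (x, μ))⁻¹ - ξ x := by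
  classical
  letI : InnerProductSpace ℝ (Matrix (Fin r.N) (Fin r.N) ℂ) := frobeniusInnerProductSpace
  -- the Lie algebra as a finite-dimensional real inner product space
  let W : Submodule ℝ (Matrix (Fin r.N) (Fin r.N) ℂ) := repLieAlgebra r
  haveI : FiniteDimensional ℝ W := inferInstance
  -- `r(g⁻¹) r(g) = 1`, `r(g) r(g⁻¹) = 1`
  have hinv1 : ∀ g : G, r.ρ g⁻¹ * r.ρ g = 1 := fun g => by rw [← map_mul, inv_mul_cancel, map_one]
  have hinv2 : ∀ g : G, r.ρ g * r.ρ g⁻¹ = 1 := fun g => by rw [← map_mul, mul_inv_cancel, map_one]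
  -- `Ad g` as a linear map of `W`
  let AdL : G → (W →ₗ[ℝ] W) := fun g =>
    { toFun := fun w => ⟨r.ρ g * (w : Matrix (Fin r.N) (Fin r.N) ℂ) * r.ρ g⁻¹, conj_mem_repLieAlgebra r g w.2⟩
      map_add' := fun a b => by ext1; simp only [Submodule.coe_add, Matrix.mul_add, Matrix.add_mul]
      map_smul' := fun t a => by
        ext1; simp only [Submodule.coe_smul, RingHom.id_apply, Matrix.mul_smul, Matrix.smul_mul] }
  have hAdL : ∀ (g : G) (w : W), ((AdL g w : W) : Matrix (Fin r.N) (Fin r.N) ℂ) = r.ρ g * w * r.ρ g⁻¹ := fun g w => rfl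
  have hAdLinv : ∀ (g : G) (w : W), AdL g⁻¹ (AdL g w) = w := fun g w => by
    ext1
    rw [hAdL, hAdL, inv_inv]
    calc r.ρ g⁻¹ * (r.ρ g * (w : Matrix (Fin r.N) (Fin r.N) ℂ) * r.ρ g⁻¹) * r.ρ g
        = (r.ρ g⁻¹ * r.ρ g) * (w : Matrix (Fin r.N) (Fin r.N) ℂ) * (r.ρ g⁻¹ * r.ρ g) := by noncomm_ring
      _ = w := by rw [hinv1, one_mul, mul_one]
  have hAdLinv' : ∀ (g : G) (w : W), AdL g (AdL g⁻¹ w) = w := fun g w => by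
    have := hAdLinv g⁻¹ w
    rwa [inv_inv] at this
  have hAdLnorm : ∀ (g : G) (w : W), ‖AdL g w‖ = ‖w‖ := fun g w => by
    change ‖(r.ρ g * (w : Matrix (Fin r.N) (Fin r.N) ℂ) * r.ρ g⁻¹ : Matrix (Fin r.N) (Fin r.N) ℂ)‖ =
      ‖(w : Matrix (Fin r.N) (Fin r.N) ℂ)‖
    rw [Matrix.frobenius_norm_mul_unitaryGroup (r.ρ g * (w : Matrix (Fin r.N) (Fin r.N) ℂ)) ⟨r.ρ g⁻¹, r.mem_unitary _⟩,
      Matrix.frobenius_norm_unitaryGroup_mul ⟨r.ρ g, r.mem_unitary _⟩]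
  -- `Ad g` as a linear isometric automorphism of `W`
  let Ad : G → (W ≃ₗᵢ[ℝ] W) := fun g =>
    { toLinearEquiv :=
        { toLinearMap := AdL g
          invFun := AdL g⁻¹
          left_inv := fun w => hAdLinv g w
          right_inv := fun w => hAdLinv' g w }
      norm_map' := fun w => hAdLnorm g w }
  have hAd : ∀ (g : G) (w : W), ((Ad g w : W) : Matrix (Fin r.N) (Fin r.N) ℂ) = r.ρ g * w * r.ρ g⁻¹ := fun g w => rfl
  -- the lattice connection `A(e) = Ad (U₀ e)` is flat on `W`
  let A : Edge d S → (W ≃ₗᵢ[ℝ] W) := fun e => Ad (U₀ e)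
  -- plaquette holonomies are central: `U(x,μ) U(x+μ,ν) = c · U(x,ν) U(x+ν,μ)` with `c ∈ Z(G)`
  have hplane : ∀ (x : Site d S) (μ ν : Fin d), ∃ c : G, c ∈ Subgroup.center G ∧
      U₀ (x, μ) * U₀ (x.shift μ, ν) = c * (U₀ (x, ν) * U₀ (x.shift ν, μ)) := by
    intro x μ ν
    rcases lt_trichotomy μ ν with hlt | heq | hgt
    · have h := htf (x, ⟨(μ, ν), hlt⟩)
      simp only at h
      set t : G := (if (⟨(μ, ν), hlt⟩ : {p : Fin d × Fin d // p.1 < p.2}) = q ∧ x q.1.1 = 0 ∧ x q.1.2 = 0 then z else 1)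
        with ht
      have htc : t ∈ Subgroup.center G := by rw [ht]; split_ifs; exacts [hz, one_mem _]
      refine ⟨t⁻¹, inv_mem htc, ?_⟩
      -- `t * (a b c⁻¹ d⁻¹) = 1 ⇒ a b = t⁻¹ (d c)`
      have h1 : plaquetteHolonomy U₀ x μ ν = t⁻¹ := eq_inv_of_mul_eq_one_right h
      simp only [plaquetteHolonomy] at h1
      calc U₀ (x, μ) * U₀ (x.shift μ, ν)
          = U₀ (x, μ) * U₀ (x.shift μ, ν) * (U₀ (x.shift ν, μ))⁻¹ * (U₀ (x, ν))⁻¹ * (U₀ (x, ν) * U₀ (x.shift ν, μ)) := by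
            group
        _ = t⁻¹ * (U₀ (x, ν) * U₀ (x.shift ν, μ)) := by rw [h1]
    · subst heq; exact ⟨1, one_mem _, by rw [one_mul]⟩
    · have h := htf (x, ⟨(ν, μ), hgt⟩)
      simp only at h
      set t : G := (if (⟨(ν, μ), hgt⟩ : {p : Fin d × Fin d // p.1 < p.2}) = q ∧ x q.1.1 = 0 ∧ x q.1.2 = 0 then z else 1)
        with ht
      have htc : t ∈ Subgroup.center G := by rw [ht]; split_ifs; exacts [hz, one_mem _]
      refine ⟨t, htc, ?_⟩
      have h1 : plaquetteHolonomy U₀ x ν μ = t⁻¹ := eq_inv_of_mul_eq_one_right h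
      simp only [plaquetteHolonomy] at h1
      -- `ν μ`-plaquette: `U(x,ν) U(x+ν,μ) U(x+μ,ν)⁻¹ U(x,μ)⁻¹ = t⁻¹`
      have h2 : U₀ (x, ν) * U₀ (x.shift ν, μ) = t⁻¹ * (U₀ (x, μ) * U₀ (x.shift μ, ν)) := by
        calc U₀ (x, ν) * U₀ (x.shift ν, μ)
            = U₀ (x, ν) * U₀ (x.shift ν, μ) * (U₀ (x.shift μ, ν))⁻¹ * (U₀ (x, μ))⁻¹ * (U₀ (x, μ) * U₀ (x.shift μ, ν)) := by
              group
          _ = t⁻¹ * (U₀ (x, μ) * U₀ (x.shift μ, ν)) := by rw [h1]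
      rw [h2, ← mul_assoc, mul_inv_cancel, one_mul]
  -- `Ad` is multiplicative and the centre acts trivially on `W`
  have hAdmul : ∀ (a b : G) (w : W), Ad a (Ad b w) = Ad (a * b) w := fun a b w => by
    ext1
    simp only [hAd, map_mul, mul_inv_rev]
    noncomm_ring
  have hAdcent : ∀ c : G, c ∈ Subgroup.center G → ∀ w : W, Ad c w = w := fun c hc w => by
    ext1
    rw [hAd, rho_center_mul_eq_mul r hc w.2, mul_assoc, hinv2, mul_one]
  have hflat : ∀ (x : Site d S) (μ ν : Fin d) (w : W), A (x, μ) (A (x.shift μ, ν) w) = A (x, ν) (A (x.shift ν, μ) w) := by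
    intro x μ ν w
    obtain ⟨c, hc, hrel⟩ := hplane x μ ν
    show Ad (U₀ (x, μ)) (Ad (U₀ (x.shift μ, ν)) w) = Ad (U₀ (x, ν)) (Ad (U₀ (x.shift ν, μ)) w)
    rw [hAdmul, hAdmul, hrel, ← hAdmul c, hAdcent c hc]
  -- `h⁰ = 0`: pair-rigidity ⇒ finite stabiliser ⇒ no covariantly constant `𝔤`-section
  have hstab : Set.Finite {g : Site d S → G | gaugeTransform g U₀ = U₀} := by
    refine finite_stabilizer_of_twistedFlat U₀ q z hz hrig fun x => ?_
    have h := htf (x, q)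
    simpa only [true_and] using h
  have h0 : ∀ f : Site d S → W, (∀ x μ, A (x, μ) (f (x.shift μ)) = f x) → f = 0 := by
    intro f hf
    have hF := covConst_eq_zero_of_finite_stabilizer r.ρ r.injective U₀ hstab
      (fun x => ((f x : W) : Matrix (Fin r.N) (Fin r.N) ℂ))
      (fun x t => by
        have hm := (mem_repLieAlgebra_iff r).1 (f x).2 t
        exact hm)
      (fun x μ => by
        have h := congrArg (fun w : W => (w : Matrix (Fin r.N) (Fin r.N) ℂ)) (hf x μ)
        simp only [A, hAd] at h
        calc r.ρ (U₀ (x, μ)) * ((f (x.shift μ) : W) : Matrix (Fin r.N) (Fin r.N) ℂ)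
            = r.ρ (U₀ (x, μ)) * ((f (x.shift μ) : W) : Matrix (Fin r.N) (Fin r.N) ℂ) * r.ρ (U₀ (x, μ))⁻¹ *
                r.ρ (U₀ (x, μ)) := by rw [mul_assoc _ (r.ρ (U₀ (x, μ))⁻¹), hinv1, mul_one]
          _ = ((f x : W) : Matrix (Fin r.N) (Fin r.N) ℂ) * r.ρ (U₀ (x, μ)) := by rw [h])
    funext x
    ext1
    have := congrFun hF x
    simpa using this
  -- the cocycle in `W`
  let Xw : Fin d → Site d S → W := fun μ x => ⟨X μ x, hX μ x⟩
  have hXw : ∀ (x : Site d S) (μ ν : Fin d),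
      A (x, μ) (Xw ν (x.shift μ)) - Xw ν x = A (x, ν) (Xw μ (x.shift ν)) - Xw μ x := by
    intro x μ ν
    ext1
    simp only [Submodule.coe_sub, A, hAd]
    exact hcoc x μ ν
  obtain ⟨ξ, hξ⟩ := lattice_cocycle_exact A hflat h0 Xw hXw
  refine ⟨fun x => ((ξ x : W) : Matrix (Fin r.N) (Fin r.N) ℂ), fun x => (ξ x).2, fun x μ => ?_⟩
  have h := congrArg (fun w : W => (w : Matrix (Fin r.N) (Fin r.N) ℂ)) (hξ x μ)
  simpa only [Submodule.coe_sub, A, hAd] using h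

end Summit.QuantumFields.YangMills.Theorems.TwistExponentGap

end
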